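import Summits.Ventures.HSemireg.UntwistAtiyahStepCommute
import Summits.Ventures.HSemireg.UntwistCocycleTwistAtiyahHigher
import HarnessLib

/-!
# Venture HSemireg — route R1.0, rows `q ≥ 2`: (L5) centrality ON THE TWIST `E⟨c⟩` — the bridge to gs-g4's `ν′_j`
# (th-4; joins `UntwistAtiyahStepCommute` to `UntwistCocycleTwistAtiyahHigher`)

HONEST FRAMING. Module-level homological algebra on the tree's real carriers. gs-g4's (A2′)
(`CocycleTwist.atiyahClassStep_twist`) produces the class `[ν′_j] = classOf (CocycleTwist.twistWedgeFamily c E j W hWU)`,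
the cochain `ψ ↦ ψ ≫ (ω_{xy} ∧ –)` on `E⟨c⟩ ⊗ Ωʲ` with `ω_{xy} = dlog g_{xy}` (`CocycleTwist.dlogForm`); th-4's (L5)
(`atiyahClassStep_comp_wedgeClass…`) is stated for the wedge family `φ ↦ φ ≫ wedgeForm j (θ_{xy})` of ANY scalar
Čech `1`-cocycle of `1`-forms `θ`. This file records that the two families AGREE DEFINITIONALLY
(`CocycleTwist.wedgeHomAt = wedgeForm`, `twistWedgeFamily = fun β ↦ postcompOver _ (wedgeForm j (dlogForm …))`, both
`rfl`), that `θ := dlog` satisfies the cocycle hypothesis of (L5) (`dlogForm_face_cocycle`, from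
`CocycleTwist.dlogForm_cocycle` + `map_dlogForm`), and hence **`[ν′_j] · at_{j+1}(E⟨c⟩) = at_j(E⟨c⟩) · [ν′_{j+1}]`** on
the `Ω¹`-free branch (`atiyahClassStep_comp_twistWedgeClass_of_cotangentSheaf_free`; the arbitrary-coframe version
follows verbatim from `UntwistAtiyahStepCommuteLocFree.atiyahClassStep_comp_wedgeClass_of_coframes` once that file is
in the tree). Nothing about any variety; nothing here says HC, HC_CM or HC_AV is proved.

Which Ext groups: `Ext¹(E⟨c⟩⊗Ωʲ, E⟨c⟩⊗Ωʲ⁺¹) ∋ at_j(E⟨c⟩), [ν′_j]`, `Ext²(E⟨c⟩⊗Ωʲ, E⟨c⟩⊗Ωʲ⁺²)`; which class: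
`at_j(E⟨c⟩)` and `[dlog c]`; which twist: the cocycle twist `E⟨c⟩ = CocycleTwist.twist c E`.

## References

* M. F. Atiyah, *Complex analytic connections in fibre bundles*, Trans. AMS 85 (1957), §4 Prop. 12 (the class of a
  line bundle / of a cocycle as `[dlog g_{xy}]`). [Atiyah1957]
* R.-O. Buchweitz, H. Flenner, Compositio Math. 137 (2003), Prop. 3.11 / 3.12 (powers of the Atiyah class and the
  semiregularity map; graded centrality of `H¹(Ω¹)` acting on `Ext`). [BuchweitzFlenner2003]
-/

set_option backward.isDefEq.respectTransparency false

noncomputable section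

universe u

open CategoryTheory CategoryTheory.Abelian AlgebraicGeometry Opposite TopologicalSpace Limits

namespace Summit.Ventures.HSemireg

namespace AtiyahStepCommute

open Literature.AlgebraicGeometry.Modules Literature.AlgebraicGeometry.Motives
  Literature.AlgebraicGeometry.HodgeTheory Literature.AlgebraicGeometry.Modules.Cech

variable {S : Type u} [CommRing S] {X : Over (Spec (CommRingCat.of S))} (c : UnitCocycle X.left)
  (E : X.left.Modules) (j : ℕ)

/-- gs-g4's local wedge homomorphism `(η ∧ –)| : Ωʲ|_V → Ωʲ⁺¹|_V` IS th-4's `wedgeForm j η` (definitionally).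
[folklore] -/
theorem wedgeHomAt_eq_wedgeForm {V : X.left.Opens} (η : Γ(cotangentSheaf X, V)) :
    CocycleTwist.wedgeHomAt j η = wedgeForm j η :=
  rfl

/-- gs-g4's `ν′_j`-cochain `twistWedgeFamily c E j W hWU` IS th-4's wedge family `φ ↦ φ ≫ wedgeForm j (θ_{xy})` with
`θ_{xy} := dlog g_{xy}` on `W_x ∩ W_y` (definitionally). [folklore] -/
theorem twistWedgeFamily_eq_postcompOver_wedgeForm (W : X.left → X.left.Opens) (hWU : ∀ x, W x ≤ c.U x) :
    CocycleTwist.twistWedgeFamily c E j W hWU = fun β =>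
      CocycleTwist.postcompOver (dual (CocycleTwist.twist c E))
        (wedgeForm j (CocycleTwist.dlogForm c (β 0) (β 1) (face W β) ((face_le _ β 0).trans (hWU (β 0)))
          ((face_le _ β 1).trans (hWU (β 1))))) :=
  rfl

/-- **`dlog` is a Čech `1`-cocycle of `1`-forms, in the face form (L5) consumes**: on `W_{τ0} ∩ W_{τ1} ∩ W_{τ2}`,
`ω_{τ0 τ2}| = ω_{τ1 τ2}| + ω_{τ0 τ1}|` (from `CocycleTwist.dlogForm_cocycle`: `ω_{yz} - ω_{xz} + ω_{xy} = 0`, and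
`map_dlogForm`). [cite: Atiyah1957, §4 Prop. 12] -/
theorem dlogForm_face_cocycle (W : X.left → X.left.Opens) (hWU : ∀ x, W x ≤ c.U x) (τ : Fin 3 → X.left) :
    (cotangentSheaf X).presheaf.map (homOfLE (face_le_face_comp W τ (Fin.succAbove 1))).op
        ((fun β : Fin 2 → X.left => CocycleTwist.dlogForm c (β 0) (β 1) (face W β)
          ((face_le _ β 0).trans (hWU (β 0))) ((face_le _ β 1).trans (hWU (β 1)))) (τ ∘ Fin.succAbove 1)) =
      (cotangentSheaf X).presheaf.map (homOfLE (face_le_face_comp W τ (Fin.succAbove 0))).op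
          ((fun β : Fin 2 → X.left => CocycleTwist.dlogForm c (β 0) (β 1) (face W β)
            ((face_le _ β 0).trans (hWU (β 0))) ((face_le _ β 1).trans (hWU (β 1)))) (τ ∘ Fin.succAbove 0)) +
        (cotangentSheaf X).presheaf.map (homOfLE (face_le_face_comp W τ (Fin.succAbove 2))).op
          ((fun β : Fin 2 → X.left => CocycleTwist.dlogForm c (β 0) (β 1) (face W β)
            ((face_le _ β 0).trans (hWU (β 0))) ((face_le _ β 1).trans (hWU (β 1)))) (τ ∘ Fin.succAbove 2)) := by
  dsimp only
  rw [CocycleTwist.map_dlogForm, CocycleTwist.map_dlogForm, CocycleTwist.map_dlogForm]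
  have h := CocycleTwist.dlogForm_cocycle c (τ 0) (τ 1) (τ 2) (face W τ) ((face_le W τ 0).trans (hWU (τ 0)))
    ((face_le W τ 1).trans (hWU (τ 1))) ((face_le W τ 2).trans (hWU (τ 2)))
  rw [sub_add_eq_add_sub, sub_eq_zero] at h
  exact h.symm

variable [HasExt.{u + 1} X.left.Modules]

/-- **(L5) on the twist, `Ω¹`-free branch: `[ν′_j] · at_{j+1}(E⟨c⟩) = at_j(E⟨c⟩) · [ν′_{j+1}]`** in
`Ext²(E⟨c⟩ ⊗ Ωʲ, E⟨c⟩ ⊗ Ωʲ⁺²)` (Mathlib `Ext.comp` order), for any framing `𝔢` of `E⟨c⟩` on opens `𝔢.U x ⊆ c.U x`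
covering `X` (e.g. `E` finite locally free: restrict a frame of `E` and the twist trivialisation to
`trivNbhd ∩ c.U x`) and `Ω¹_{X/S} ≅ 𝒪^I` with `I` finite. Immediate from
`atiyahClassStep_comp_wedgeClass_of_cotangentSheaf_free` with `θ := dlog` (`dlogForm_face_cocycle`); the two
`ν′`-classes are gs-g4's `classOf (twistWedgeFamily c E _ 𝔢.U hWU)` on the nose
(`twistWedgeFamily_eq_postcompOver_wedgeForm` is `rfl`). [cite: BuchweitzFlenner2003, Prop. 3.12] -/
theorem atiyahClassStep_comp_twistWedgeClass_of_cotangentSheaf_free {I₁ : Type u} [Finite I₁]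
    (hΩ : Nonempty (cotangentSheaf X ≅ SheafOfModules.free I₁)) (𝔢 : Framing (CocycleTwist.twist c E) X.left)
    (hWU : ∀ x, 𝔢.U x ≤ c.U x) (hcov : iSup 𝔢.U = ⊤) :
    (classOf (exactAugmentation 𝔢.U (twistHodge (CocycleTwist.twist c E) (j + 1)) hcov)
          (CocycleTwist.twistWedgeFamily c E j 𝔢.U hWU) (CocycleTwist.dFamily_twistWedgeFamily c E j 𝔢.U hWU)).comp
        (atiyahClassStep (CocycleTwist.twist c E) (j + 1)) rfl =
      (atiyahClassStep (CocycleTwist.twist c E) j).comp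
        (classOf (exactAugmentation 𝔢.U (twistHodge (CocycleTwist.twist c E) (j + 1 + 1)) hcov)
          (CocycleTwist.twistWedgeFamily c E (j + 1) 𝔢.U hWU)
          (CocycleTwist.dFamily_twistWedgeFamily c E (j + 1) 𝔢.U hWU)) rfl :=
  atiyahClassStep_comp_wedgeClass_of_cotangentSheaf_free hΩ 𝔢 hcov _ (dlogForm_face_cocycle c 𝔢.U hWU)

end AtiyahStepCommute

end Summit.Ventures.HSemireg

end
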